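import Mathlib
import Summits.NavierStokesRegularity.NavierStokesRegularity.Theorems.EulerZoomLiouvillePowerGaugeEulerLiouvilleSwirlCapacityEndgame
import Summits.NavierStokesRegularity.NavierStokesRegularity.Theorems.EulerZoomLiouvillePowerGaugeEulerLiouvilleSwirlCapacityPowerFloors
import HarnessLib

/-!
# Crux `EulerZoomLiouville.PowerGaugeEulerLiouville` (stmt-NavierStokesRegularity-19832), line `swirl-capacity`:
# THE POWER-TOLERANT SWIRL ENDGAME (D3_pow — the stratum dies under ANY sub-power loss in the capacity floor)

Route №10 `EulerZoomLiouville` (NavierStokesRegularity), crux E.  Line `swirl-capacity` (ideator ns-idea-11 g3;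
`Cruxes/PowerGaugeEulerLiouville/Lines/swirl_capacity.lean`, rev 2); part 2 of the power-tolerant endgame (director-ns #185 (2): «ezl-w2 g2 =
the power endgame D2′_pow + D3_pow; race e = 2−ρ+6/q < s = min(2, 1/(1−κ)) with q free — state the admissible (ρ, κ, q) region»).
The landed endgame D3 (`vanishesAE_of_swirlCapacityFloor_of_swirlBlobsPersist`, file `…SwirlCapacityEndgame`, ns-sfl-p1) consumes the LOG-SHARP
swirl floor.  Here the same skeleton (swirl blob `exists_swirl_blob` → persistent avatars inside `B(0,a/3)` on the window `(−T_a, τ₀)`,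
`T_a = c₂ a^{min(2,1/(1−κ))}` → per-slice floor → Tonelli `frobenius_window_lower_bound` → budget `setLIntegral_window_frobenius_fderiv_le`
`≤ c a^{1−ρ}`) is re-run from the POWER floor `SwirlPow_η : ∫_{B(3A)} ‖∇v‖_F² ≥ K γ₀² (V/A³)^η / A`: with `V` fixed the per-slice floor is
`≥ 3 K γ₀² V^η · a^{−1−3η}`, so the race reads `c₂ κ₀ a^s > c a^{max(2−ρ+3η, 0)} + |τ₀| κ₀` for large `a` — `eventually_dominates` with NO
logarithm — and is won iff `2 − ρ + 3η < s = min(2, 1/(1−κ))`.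

ADMISSIBLE REGION (one Sobolev exponent `q ≥ 2`, `η = 2/q`, the currency of the power-lossy lever D2_pow
`∀ q ≥ 2, ∃ K_q > 0, ∫_{B(3A)} ‖∇f‖²/r² ≥ K_q γ₀² (V/A³)^{2/q} / A` being landed as `…SwirlCapacityAxisFloorPlanar` / `…AxisFloorMeridional` /
`…AxisFloor` by ns-cas-k2):  `2 − ρ + 6/q < min(2, 1/(1−κ))`, i.e. `q > 6 / (min(2, 1/(1−κ)) − (2 − ρ))`; it is non-empty in `q` exactly
when `κ > (1−ρ)/(2−ρ)` — the line's threshold (`exponent_race` in the line file) — so with ALL `q ≥ 2` available the whole stratum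
`IsSwirlingSlowDrifting` is covered, and with ONE `q` the sub-stratum `κ > 1 − 1/(2 − ρ + 6/q)` (for `ρ > 6/q`).

* `false_of_swirlCapacityFloorPowAt_of_swirlBlobsPersist` — THE RACE at one exponent `η`: `SwirlPow_η` + classical axisymmetric member with
  drift data `(M, κ)` in the region `2 − ρ + 3η < min(2, 1/(1−κ))` + swirl somewhere + persistent swirl blobs + `E`-gauge ⇒ `False`;
* `vanishesAE_of_swirlCapacityFloorPow_of_swirlBlobsPersist` — D3 in the registered binder shape from `SwirlPow_η` for all `η ∈ (0,1]`
  (`η := min(1, gap/6)`);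
* `vanishesAE_of_axisCapacityFloorPowAt_of_swirlBlobsPersist` — D3_pow at ONE `q ≥ 2` from the axis power floor `AxisPow_{2/q}` (velocity step
  `swirlCapacityFloorPowAt_of_axisCapacityFloorPowAt`, part 1), members in the admissible region, no upper bound on `ρ` needed.

Part 3 (`…SwirlCapacityEndgameDoors`) feeds the three typed levers (square-log D2sq = rev-2 stub D3sq BY NAME, power-lossy D2_pow, log-sharp D2)
through this one endgame.

WHAT THIS IS NOT: not NS, not the crux — a helper `--supports` stmt-19832 on the line `swirl-capacity` (strata lemmas about a hypothetical
class of ancient Euler solutions; the levers and the residue D4 are NOT touched here); no summit statement is proved here.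
[cite: MajdaBertozziCUP2002, §2.3.3 (2.67); CaffarelliKohnNirenberg1982, §2 (the scaled dissipation)]
-/

noncomputable section

-- flat `Theorems/<Route><Decl>…` files of one crux share the namespace of the crux (tree convention)
set_option linter.dupNamespace false

open MeasureTheory Set Filter Topology Metric Function
open scoped NNReal ENNReal

namespace Summit.NavierStokesRegularity.NavierStokesRegularity.Theorems.PowerGaugeEulerLiouville.SwirlCapacity

open Literature.Analysis Literature.Analysis.FluidPDE
open Summit.NavierStokesRegularity.NavierStokesRegularity.Theorems.PowerGaugeEulerLiouville.SwirlfreeLedger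

/-! ### The race at one exponent -/

variable {u : ℝ → EuclideanSpace ℝ (Fin 3) → EuclideanSpace ℝ (Fin 3)} {p : ℝ → EuclideanSpace ℝ (Fin 3) → ℝ}

/-- **THE RACE (one exponent `η`)**: a classical axisymmetric member of the `E`-gauged class with drift data `(M, κ)`, `κ < 1`, swirl
somewhere in the past and persistent swirl blobs is IMPOSSIBLE as soon as a swirl power floor holds at an exponent `η > 0` with
`2 − ρ + 3η < min(2, 1/(1−κ))`: presence `T_a = c₂ a^{min(2,1/(1−κ))}` times the per-slice floor `≥ 3 K γ₀² V^η a^{−1−3η}` exceeds the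
budget `c a^{1−ρ}` for large `a` (`eventually_dominates` with no logarithm). [cite: CaffarelliKohnNirenberg1982, §2] -/
theorem false_of_swirlCapacityFloorPowAt_of_swirlBlobsPersist {η K : ℝ} (hη : 0 < η) (hK : 0 < K)
    (hfloor : ∀ (v : EuclideanSpace ℝ (Fin 3) → EuclideanSpace ℝ (Fin 3)) (T : Set (EuclideanSpace ℝ (Fin 3))) (A V γ₀ : ℝ),
      ContDiff ℝ 1 v → IsAxisymmetric v →
      0 < A → 0 < V → 0 < γ₀ → MeasurableSet T → T ⊆ ball (0 : EuclideanSpace ℝ (Fin 3)) A →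
      ENNReal.ofReal V ≤ volume T → (∀ x ∈ T, γ₀ ≤ |swirl v x|) →
        ENNReal.ofReal (K * γ₀ ^ 2 * (V / A ^ 3) ^ η / A) ≤
          ∫⁻ x in ball (0 : EuclideanSpace ℝ (Fin 3)) (3 * A), ENNReal.ofReal (frobeniusNormSq (fderiv ℝ v x)))
    {ρ : ℝ} {H : ℝ → EuclideanSpace ℝ (Fin 3) → EuclideanSpace ℝ (Fin 3) →L[ℝ] EuclideanSpace ℝ (Fin 3)} {c : ℝ≥0}
    (hH : HasWeakSpatialGradientOn (slab (EuclideanSpace ℝ (Fin 3)) (Set.Iio 0) isOpen_Iio) u H)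
    (hE : ∀ a : ℝ, 0 < a → ENNReal.ofReal (a ^ ρ) * cknE a (0 : ℝ × EuclideanSpace ℝ (Fin 3)) H ≤ (c : ℝ≥0∞))
    (hcl : IsClassicalEulerSolutionOn (Set.Iio 0) 0 u p) (hsym : ∀ τ : ℝ, τ < 0 → IsAxisymmetric (u τ))
    {M κ : ℝ} (hM0 : 0 ≤ M) (hκ1 : κ < 1) (hrace : 2 - ρ + 3 * η < min 2 (1 / (1 - κ)))
    {τ₀ : ℝ} (hτ₀ : τ₀ < 0) {x₁ : EuclideanSpace ℝ (Fin 3)} (hx₁ : swirl (u τ₀) x₁ ≠ 0)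
    (hpersist : ∀ t₀ : ℝ, t₀ < 0 → ∀ (x₀ : EuclideanSpace ℝ (Fin 3)) (δ γ₀ : ℝ), 0 < δ → δ < cylRadius x₀ →
      (∀ x ∈ ball x₀ δ, γ₀ ≤ |swirl (u t₀) x|) →
      ∀ t₁ : ℝ, t₁ < t₀ →
        ∃ T : Set (EuclideanSpace ℝ (Fin 3)), MeasurableSet T ∧
          T ⊆ ball (0 : EuclideanSpace ℝ (Fin 3)) (‖x₀‖ + δ + M / (1 - κ) * ((-t₁) ^ (1 - κ) - (-t₀) ^ (1 - κ))) ∧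
          (∀ x ∈ T, γ₀ ≤ |swirl (u t₁) x|) ∧ volume (ball x₀ δ) ≤ volume T) : False := by
  -- adapted from `vanishesAE_of_swirlCapacityFloor_of_swirlBlobsPersist` (…SwirlCapacityEndgame, ns-sfl-p1): same skeleton, power floor
  have hu1 : ∀ t : ℝ, t < 0 → ContDiff ℝ 1 (u t) := fun t ht => (hcl.contDiff_velocity ht).of_le (by exact_mod_cast le_top)
  obtain ⟨δ, γ₀, V, hδ, hδr, hγ₀, hV, hlev, hVball⟩ := exists_swirl_blob (hu1 τ₀ hτ₀).continuous hx₁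
  -- the exponents: `e = max (2 - ρ + 3η) 0 < s = min 2 (1/(1-κ))`
  have h1κ : 0 < 1 - κ := by linarith
  set γ : ℝ := 1 / (1 - κ) with hγ
  have hγ0 : 0 < γ := by positivity
  set s : ℝ := min 2 γ with hs
  have hs0 : 0 < s := lt_min two_pos hγ0
  set e : ℝ := max (2 - ρ + 3 * η) 0 with he
  have hes : e < s := max_lt hrace hs0
  have he0 : 0 ≤ e := le_max_right _ _
  have hee : 2 - ρ + 3 * η ≤ e := le_max_left _ _
  have hs2 : s ≤ 2 := min_le_left _ _
  have hsγ : s ≤ γ := min_le_right _ _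
  -- the constants of the window length `T_a = c₂ a^s`
  set M' : ℝ := max M 1 with hM'
  have hM'0 : 0 < M' := lt_of_lt_of_le one_pos (le_max_right _ _)
  have hMM' : M ≤ M' := le_max_left _ _
  set q : ℝ := (1 - κ) / (6 * M') with hq
  have hq0 : 0 < q := by positivity
  set c₁ : ℝ := q ^ γ with hc₁
  have hc₁0 : 0 < c₁ := Real.rpow_pos_of_pos hq0 _
  set c₂ : ℝ := min 1 c₁ with hc₂
  have hc₂0 : 0 < c₂ := lt_min one_pos hc₁0
  have hc₂1 : c₂ ≤ 1 := min_le_left _ _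
  have hc₂c₁ : c₂ ≤ c₁ := min_le_right _ _
  -- the per-slice floor constant `κ₀ = 3 K γ₀² V^η`
  set κ₀ : ℝ := 3 * K * γ₀ ^ 2 * V ^ η with hκ₀
  have hVη : 0 < V ^ η := Real.rpow_pos_of_pos hV _
  have hκ₀0 : 0 < κ₀ := by positivity
  -- the exponent race (no logarithm: `C₁ = 0`)
  obtain ⟨A, hA1, hA⟩ := eventually_dominates (e := e) (s := s) (c := c₂ * κ₀) he0 hes (by positivity)
    0 (c : ℝ) (-τ₀ * κ₀)
  -- the radius `a`
  set a : ℝ := max A (6 * (‖x₁‖ + δ)) with ha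
  have haA : A ≤ a := le_max_left _ _
  have ha1 : 1 ≤ a := le_trans hA1 haA
  have ha0 : 0 < a := by linarith
  have hax : 6 * (‖x₁‖ + δ) ≤ a := le_max_right _ _
  have hrace' := hA a haA
  -- the window length
  set Ta : ℝ := c₂ * a ^ s with hTa
  have hTa0 : 0 < Ta := by positivity
  have has2 : a ^ s ≤ a ^ 2 := by
    rw [show a ^ 2 = a ^ (2 : ℝ) from (Real.rpow_two a).symm]
    exact Real.rpow_le_rpow_of_exponent_le ha1 hs2
  have hTa2 : Ta ≤ a ^ 2 := by
    calc Ta ≤ 1 * a ^ s := mul_le_mul_of_nonneg_right hc₂1 (Real.rpow_nonneg ha0.le _)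
      _ ≤ a ^ 2 := by rw [one_mul]; exact has2
  have hTaγ : Ta ≤ c₁ * a ^ γ :=
    mul_le_mul hc₂c₁ (Real.rpow_le_rpow_of_exponent_le ha1 hsγ) (Real.rpow_nonneg ha0.le _) hc₁0.le
  -- the drift radius on the window `(−T_a, τ₀)` is at most `a/6`
  have hdrift : ∀ t₁ ∈ Ioo (-Ta) τ₀, M / (1 - κ) * ((-t₁) ^ (1 - κ) - (-τ₀) ^ (1 - κ)) ≤ a / 6 := by
    intro t₁ ht₁
    have hnt₁ : 0 < -t₁ := by linarith [ht₁.2]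
    have h0 : 0 ≤ (-τ₀) ^ (1 - κ) := Real.rpow_nonneg (by linarith) _
    have h1 : (-t₁) ^ (1 - κ) ≤ (c₁ * a ^ γ) ^ (1 - κ) :=
      Real.rpow_le_rpow hnt₁.le (by linarith [ht₁.1]) h1κ.le
    have h2 : (c₁ * a ^ γ) ^ (1 - κ) = q * a := by
      rw [Real.mul_rpow hc₁0.le (Real.rpow_nonneg ha0.le _), hc₁, ← Real.rpow_mul hq0.le, ← Real.rpow_mul ha0.le, hγ,
        one_div_mul_cancel h1κ.ne', Real.rpow_one, Real.rpow_one]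
    calc M / (1 - κ) * ((-t₁) ^ (1 - κ) - (-τ₀) ^ (1 - κ)) ≤ M / (1 - κ) * (q * a) := by
          refine mul_le_mul_of_nonneg_left ?_ (div_nonneg hM0 h1κ.le)
          linarith [h1, h2]
      _ ≤ M' / (1 - κ) * (q * a) := by gcongr
      _ = a / 6 := by rw [hq]; field_simp
  -- per-slice floor on the window (power floor at `A = a/3`)
  set F : ℝ := K * γ₀ ^ 2 * (V / (a / 3) ^ 3) ^ η / (a / 3) with hF
  have hy0 : 0 < V / (a / 3) ^ 3 := by positivity
  have hF0 : 0 ≤ F := by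
    rw [hF]
    exact div_nonneg (mul_nonneg (by positivity) (Real.rpow_nonneg hy0.le _)) (by positivity)
  have hslice : ∀ t₁ ∈ Ioo (-Ta) τ₀, ENNReal.ofReal F ≤
      ∫⁻ x in ball (0 : EuclideanSpace ℝ (Fin 3)) a, ENNReal.ofReal (frobeniusNormSq (fderiv ℝ (u t₁) x)) := by
    intro t₁ ht₁
    have ht₁0 : t₁ < 0 := lt_trans ht₁.2 hτ₀
    obtain ⟨T, hTm, hTsub, hTlev, hTvol⟩ := hpersist τ₀ hτ₀ x₁ δ γ₀ hδ hδr hlev t₁ ht₁.2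
    have hTa3 : T ⊆ ball (0 : EuclideanSpace ℝ (Fin 3)) (a / 3) := by
      refine hTsub.trans (ball_subset_ball ?_)
      linarith [hdrift t₁ ht₁]
    have hfl := hfloor (u t₁) T (a / 3) V γ₀ (hu1 t₁ ht₁0) (hsym t₁ ht₁0) (by positivity) hV hγ₀ hTm hTa3
      (hVball.trans hTvol) hTlev
    have h3 : 3 * (a / 3) = a := by ring
    rw [h3] at hfl
    exact hfl
  -- integrate over the window and compare with the budget
  have hlow := frobenius_window_lower_bound hcl (a := a) (α := -Ta) (β := τ₀) (F := F) (by linarith) hτ₀.le hF0 hslice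
  have hbud := setLIntegral_window_frobenius_fderiv_le hH hcl hE ha0 (ρ := ρ)
  have hreal : (τ₀ - -Ta) * F ≤ (c : ℝ) * a ^ (1 - ρ) :=
    (ENNReal.ofReal_le_ofReal_iff (by positivity)).1 (hlow.trans hbud)
  -- the floor is at least `κ₀ a^{-(1+3η)}`: `κ₀ ≤ F · a^{1+3η}`
  have ha3η : 0 < a ^ (3 * η) := Real.rpow_pos_of_pos ha0 _
  have hpow3 : (a ^ 3 : ℝ) ^ η = a ^ (3 * η) := by
    rw [← Real.rpow_natCast a 3, ← Real.rpow_mul ha0.le]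
    norm_num
  have hmono : (V / a ^ 3) ^ η ≤ (V / (a / 3) ^ 3) ^ η := by
    refine Real.rpow_le_rpow (by positivity) ?_ hη.le
    refine div_le_div_of_nonneg_left hV.le (by positivity) ?_
    have : a / 3 ≤ a := by linarith
    exact pow_le_pow_left₀ (by positivity) this 3
  have hVa : (V / a ^ 3) ^ η * a ^ (3 * η) = V ^ η := by
    rw [Real.div_rpow hV.le (by positivity), hpow3, div_mul_cancel₀ _ ha3η.ne']
  have hFlow : κ₀ ≤ F * a ^ (1 + 3 * η) := by
    have e1 : F * a ^ (1 + 3 * η) = 3 * K * γ₀ ^ 2 * ((V / (a / 3) ^ 3) ^ η * a ^ (3 * η)) := by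
      rw [hF, Real.rpow_add ha0, Real.rpow_one]
      field_simp
    rw [e1, hκ₀, ← hVa]
    refine mul_le_mul_of_nonneg_left ?_ (by positivity)
    exact mul_le_mul_of_nonneg_right hmono ha3η.le
  -- hence `(τ₀ + T_a) κ₀ ≤ c a^{e}`
  have hae : a ^ (1 - ρ) * a ^ (1 + 3 * η) ≤ a ^ e := by
    rw [← Real.rpow_add ha0]
    have e1 : 1 - ρ + (1 + 3 * η) = 2 - ρ + 3 * η := by ring
    rw [e1]
    exact Real.rpow_le_rpow_of_exponent_le ha1 hee
  have hkey : (τ₀ + Ta) * κ₀ ≤ (c : ℝ) * a ^ e := by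
    rcases le_or_gt 0 (τ₀ + Ta) with hpos | hneg
    · calc (τ₀ + Ta) * κ₀ ≤ (τ₀ + Ta) * (F * a ^ (1 + 3 * η)) := mul_le_mul_of_nonneg_left hFlow hpos
        _ = ((τ₀ - -Ta) * F) * a ^ (1 + 3 * η) := by ring
        _ ≤ ((c : ℝ) * a ^ (1 - ρ)) * a ^ (1 + 3 * η) :=
            mul_le_mul_of_nonneg_right hreal (Real.rpow_nonneg ha0.le _)
        _ = (c : ℝ) * (a ^ (1 - ρ) * a ^ (1 + 3 * η)) := by ring
        _ ≤ (c : ℝ) * a ^ e := mul_le_mul_of_nonneg_left hae c.coe_nonneg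
    · have h1 : (τ₀ + Ta) * κ₀ < 0 := mul_neg_of_neg_of_pos hneg hκ₀0
      have h2 : 0 ≤ (c : ℝ) * a ^ e := mul_nonneg c.coe_nonneg (Real.rpow_nonneg ha0.le _)
      linarith
  -- the race says the opposite: `c a^e - τ₀ κ₀ < c₂ κ₀ a^s = T_a κ₀`
  have hTam : Ta * κ₀ = c₂ * κ₀ * a ^ s := by rw [hTa]; ring
  have hr : 0 * a ^ e * Real.log a + (c : ℝ) * a ^ e + -τ₀ * κ₀ < c₂ * κ₀ * a ^ s := hrace'
  have h0 : (0 : ℝ) * a ^ e * Real.log a = 0 := by ring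
  linarith [hkey, hr, hTam, h0]

/-! ### The power-tolerant endgame -/

/-- **D3 from the power floors**: GIVEN the swirl power floors `∫_{B(3A)} ‖∇v‖_F² ≥ K_η γ₀² (V/A³)^η / A` for every `η ∈ (0,1]`, in the
window `0 < ρ ≤ 1/2` a member of Seregin's power-gauged class which is classical axisymmetric with drift data `(M, κ)`,
`(1−ρ)/(2−ρ) < κ < 1`, carries swirl somewhere in the past and has persistent swirl blobs is trivial — indeed impossible
(`false_of_swirlCapacityFloorPowAt_of_swirlBlobsPersist` at `η = min(1, gap/6)`, `gap = min(2,1/(1−κ)) − (2−ρ) > 0`).  Same binder shape as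
the landed D3 with the floor hypothesis replaced. [cite: MajdaBertozziCUP2002, §2.3.3 (2.67); CaffarelliKohnNirenberg1982, §2] -/
theorem vanishesAE_of_swirlCapacityFloorPow_of_swirlBlobsPersist
    (hpow : ∀ η : ℝ, 0 < η → η ≤ 1 → ∃ K : ℝ, 0 < K ∧
      ∀ (v : EuclideanSpace ℝ (Fin 3) → EuclideanSpace ℝ (Fin 3)) (T : Set (EuclideanSpace ℝ (Fin 3))) (A V γ₀ : ℝ),
      ContDiff ℝ 1 v → IsAxisymmetric v →
      0 < A → 0 < V → 0 < γ₀ → MeasurableSet T → T ⊆ ball (0 : EuclideanSpace ℝ (Fin 3)) A →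
      ENNReal.ofReal V ≤ volume T → (∀ x ∈ T, γ₀ ≤ |swirl v x|) →
        ENNReal.ofReal (K * γ₀ ^ 2 * (V / A ^ 3) ^ η / A) ≤
          ∫⁻ x in ball (0 : EuclideanSpace ℝ (Fin 3)) (3 * A), ENNReal.ofReal (frobeniusNormSq (fderiv ℝ v x))) :
    ∀ ρ : ℝ, 0 < ρ → ρ ≤ 1 / 2 →
      ∀ (u : ℝ → EuclideanSpace ℝ (Fin 3) → EuclideanSpace ℝ (Fin 3)) (p : ℝ → EuclideanSpace ℝ (Fin 3) → ℝ)
        (H : ℝ → EuclideanSpace ℝ (Fin 3) → EuclideanSpace ℝ (Fin 3) →L[ℝ] EuclideanSpace ℝ (Fin 3)) (c : ℝ≥0),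
        (IsSuitableWeakSolutionOn (slab (EuclideanSpace ℝ (Fin 3)) (Set.Iio 0) isOpen_Iio) 0 0 u p ∧
            HasWeakSpatialGradientOn (slab (EuclideanSpace ℝ (Fin 3)) (Set.Iio 0) isOpen_Iio) u H ∧
            (∀ a : ℝ, 0 < a →
              ENNReal.ofReal (a ^ (2 * ρ)) * cknA a (0 : ℝ × EuclideanSpace ℝ (Fin 3)) u +
                    ENNReal.ofReal (a ^ ρ) * cknE a (0 : ℝ × EuclideanSpace ℝ (Fin 3)) H +
                  ENNReal.ofReal (a ^ (2 * ρ)) * cknD a (0 : ℝ × EuclideanSpace ℝ (Fin 3)) p ≤ (c : ℝ≥0∞))) →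
          ∀ M κ : ℝ, (1 - ρ) / (2 - ρ) < κ →
            (IsClassicalEulerSolutionOn (Set.Iio 0) 0 u p ∧
                (∀ τ : ℝ, τ < 0 → IsAxisymmetric (u τ) ∧ IsAxisymmetricScalar (p τ)) ∧
                0 ≤ M ∧ κ < 1 ∧ ∀ τ : ℝ, τ < 0 → ∀ x : EuclideanSpace ℝ (Fin 3), ‖u τ x‖ ≤ M * (-τ) ^ (-κ)) →
            (∃ τ₀ : ℝ, τ₀ < 0 ∧ ∃ x : EuclideanSpace ℝ (Fin 3), swirl (u τ₀) x ≠ 0) →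
            (∀ t₀ : ℝ, t₀ < 0 → ∀ (x₀ : EuclideanSpace ℝ (Fin 3)) (δ γ₀ : ℝ), 0 < δ → δ < cylRadius x₀ →
                (∀ x ∈ ball x₀ δ, γ₀ ≤ |swirl (u t₀) x|) →
                ∀ t₁ : ℝ, t₁ < t₀ →
                  ∃ T : Set (EuclideanSpace ℝ (Fin 3)), MeasurableSet T ∧
                    T ⊆ ball (0 : EuclideanSpace ℝ (Fin 3)) (‖x₀‖ + δ + M / (1 - κ) * ((-t₁) ^ (1 - κ) - (-t₀) ^ (1 - κ))) ∧
                    (∀ x ∈ T, γ₀ ≤ |swirl (u t₁) x|) ∧ volume (ball x₀ δ) ≤ volume T) →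
              Function.uncurry u =ᵐ[volume.restrict (Set.Iio (0 : ℝ) ×ˢ (Set.univ : Set (EuclideanSpace ℝ (Fin 3))))] 0 := by
  intro ρ hρ hρ2 u p H c hcls M κ hκρ hstr hswirl hpersist
  obtain ⟨_, hH, hgauge⟩ := hcls
  obtain ⟨hcl, hsym, hM0, hκ1, _⟩ := hstr
  obtain ⟨τ₀, hτ₀, x₁, hx₁⟩ := hswirl
  have hE : ∀ a : ℝ, 0 < a →
      ENNReal.ofReal (a ^ ρ) * cknE a (0 : ℝ × EuclideanSpace ℝ (Fin 3)) H ≤ (c : ℝ≥0∞) :=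
    fun a ha => (le_add_self.trans le_self_add).trans (hgauge a ha)
  exfalso
  -- the gap of the race and the exponent `η`
  have h1κ : 0 < 1 - κ := by linarith
  have hγe : 2 - ρ < 1 / (1 - κ) := by
    rw [lt_div_iff₀ h1κ]
    rw [div_lt_iff₀ (by linarith)] at hκρ
    nlinarith
  have hgap : 0 < min 2 (1 / (1 - κ)) - (2 - ρ) := by
    have := lt_min (show 2 - ρ < (2 : ℝ) by linarith) hγe
    linarith
  set η : ℝ := min 1 ((min 2 (1 / (1 - κ)) - (2 - ρ)) / 6) with hη
  have hη0 : 0 < η := lt_min one_pos (by positivity)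
  have hη1 : η ≤ 1 := min_le_left _ _
  have hrace : 2 - ρ + 3 * η < min 2 (1 / (1 - κ)) := by
    have : η ≤ (min 2 (1 / (1 - κ)) - (2 - ρ)) / 6 := min_le_right _ _
    linarith
  obtain ⟨K, hK, hfloor⟩ := hpow η hη0 hη1
  exact false_of_swirlCapacityFloorPowAt_of_swirlBlobsPersist hη0 hK hfloor hH hE hcl
    (fun τ hτ => (hsym τ hτ).1) hM0 hκ1 hrace hτ₀ hx₁ hpersist

/-- **D3_pow at ONE Sobolev exponent `q` (the admissible region made explicit)**: if the axis power floor holds at the single exponent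
`2/q`, `q ≥ 2` — `∫_{B(3A)} ‖∇f‖²/r² ≥ K γ₀² (V/A³)^{2/q} / A` — then every classical axisymmetric member of the `E`-gauged class with
drift data `(M, κ)`, `κ < 1`, lying in the ADMISSIBLE REGION
`2 − ρ + 6/q < min(2, 1/(1−κ))`  (equivalently `q > 6 / (min(2, 1/(1−κ)) − (2−ρ))`; non-empty in `q` exactly when `κ > (1−ρ)/(2−ρ)`,
the line's threshold, by `exponent_race`), carrying swirl somewhere in the past and persistent swirl blobs, is trivial (indeed impossible:
`false_of_swirlCapacityFloorPowAt_of_swirlBlobsPersist` at `η = 2/q` after the velocity step `swirlCapacityFloorPowAt_of_axisCapacityFloorPowAt`).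
No upper bound on `ρ` is needed here. [cite: MajdaBertozziCUP2002, §2.3.3 (2.67); CaffarelliKohnNirenberg1982, §2] -/
theorem vanishesAE_of_axisCapacityFloorPowAt_of_swirlBlobsPersist {q K : ℝ} (hq : 2 ≤ q) (hK : 0 < K)
    (hfloor : ∀ (f : EuclideanSpace ℝ (Fin 3) → ℝ) (T : Set (EuclideanSpace ℝ (Fin 3))) (A V γ₀ : ℝ),
      ContDiff ℝ 1 f → IsAxisymmetricScalar f →
      (∀ x : EuclideanSpace ℝ (Fin 3), cylRadius x = 0 → f x = 0) → 0 < A → 0 < V → 0 < γ₀ → MeasurableSet T →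
      T ⊆ ball (0 : EuclideanSpace ℝ (Fin 3)) A →
      ENNReal.ofReal V ≤ volume T → (∀ x ∈ T, γ₀ ≤ f x) →
        ENNReal.ofReal (K * γ₀ ^ 2 * (V / A ^ 3) ^ (2 / q) / A) ≤
          ∫⁻ x in ball (0 : EuclideanSpace ℝ (Fin 3)) (3 * A), ENNReal.ofReal (‖fderiv ℝ f x‖ ^ 2 / cylRadius x ^ 2)) :
    ∀ ρ : ℝ, 0 < ρ →
      ∀ (u : ℝ → EuclideanSpace ℝ (Fin 3) → EuclideanSpace ℝ (Fin 3)) (p : ℝ → EuclideanSpace ℝ (Fin 3) → ℝ)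
        (H : ℝ → EuclideanSpace ℝ (Fin 3) → EuclideanSpace ℝ (Fin 3) →L[ℝ] EuclideanSpace ℝ (Fin 3)) (c : ℝ≥0),
        (IsSuitableWeakSolutionOn (slab (EuclideanSpace ℝ (Fin 3)) (Set.Iio 0) isOpen_Iio) 0 0 u p ∧
            HasWeakSpatialGradientOn (slab (EuclideanSpace ℝ (Fin 3)) (Set.Iio 0) isOpen_Iio) u H ∧
            (∀ a : ℝ, 0 < a →
              ENNReal.ofReal (a ^ (2 * ρ)) * cknA a (0 : ℝ × EuclideanSpace ℝ (Fin 3)) u +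
                    ENNReal.ofReal (a ^ ρ) * cknE a (0 : ℝ × EuclideanSpace ℝ (Fin 3)) H +
                  ENNReal.ofReal (a ^ (2 * ρ)) * cknD a (0 : ℝ × EuclideanSpace ℝ (Fin 3)) p ≤ (c : ℝ≥0∞))) →
          ∀ M κ : ℝ, 2 - ρ + 6 / q < min 2 (1 / (1 - κ)) →
            (IsClassicalEulerSolutionOn (Set.Iio 0) 0 u p ∧
                (∀ τ : ℝ, τ < 0 → IsAxisymmetric (u τ) ∧ IsAxisymmetricScalar (p τ)) ∧
                0 ≤ M ∧ κ < 1 ∧ ∀ τ : ℝ, τ < 0 → ∀ x : EuclideanSpace ℝ (Fin 3), ‖u τ x‖ ≤ M * (-τ) ^ (-κ)) →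
            (∃ τ₀ : ℝ, τ₀ < 0 ∧ ∃ x : EuclideanSpace ℝ (Fin 3), swirl (u τ₀) x ≠ 0) →
            (∀ t₀ : ℝ, t₀ < 0 → ∀ (x₀ : EuclideanSpace ℝ (Fin 3)) (δ γ₀ : ℝ), 0 < δ → δ < cylRadius x₀ →
                (∀ x ∈ ball x₀ δ, γ₀ ≤ |swirl (u t₀) x|) →
                ∀ t₁ : ℝ, t₁ < t₀ →
                  ∃ T : Set (EuclideanSpace ℝ (Fin 3)), MeasurableSet T ∧
                    T ⊆ ball (0 : EuclideanSpace ℝ (Fin 3)) (‖x₀‖ + δ + M / (1 - κ) * ((-t₁) ^ (1 - κ) - (-t₀) ^ (1 - κ))) ∧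
                    (∀ x ∈ T, γ₀ ≤ |swirl (u t₁) x|) ∧ volume (ball x₀ δ) ≤ volume T) →
              Function.uncurry u =ᵐ[volume.restrict (Set.Iio (0 : ℝ) ×ˢ (Set.univ : Set (EuclideanSpace ℝ (Fin 3))))] 0 := by
  intro ρ hρ u p H c hcls M κ hrace hstr hswirl hpersist
  obtain ⟨_, hH, hgauge⟩ := hcls
  obtain ⟨hcl, hsym, hM0, hκ1, _⟩ := hstr
  obtain ⟨τ₀, hτ₀, x₁, hx₁⟩ := hswirl
  have hE : ∀ a : ℝ, 0 < a →
      ENNReal.ofReal (a ^ ρ) * cknE a (0 : ℝ × EuclideanSpace ℝ (Fin 3)) H ≤ (c : ℝ≥0∞) :=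
    fun a ha => (le_add_self.trans le_self_add).trans (hgauge a ha)
  exfalso
  have hq0 : 0 < q := by linarith
  have hη0 : 0 < 2 / q := by positivity
  have hη1 : 2 / q ≤ 1 := by rw [div_le_iff₀ hq0]; linarith
  have hrace' : 2 - ρ + 3 * (2 / q) < min 2 (1 / (1 - κ)) := by
    have e : 3 * (2 / q) = 6 / q := by ring
    rw [e]; exact hrace
  exact false_of_swirlCapacityFloorPowAt_of_swirlBlobsPersist hη0 (by positivity : 0 < K / 8)
    (swirlCapacityFloorPowAt_of_axisCapacityFloorPowAt hη1 hK hfloor) hH hE hcl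
    (fun τ hτ => (hsym τ hτ).1) hM0 hκ1 hrace' hτ₀ hx₁ hpersist

end Summit.NavierStokesRegularity.NavierStokesRegularity.Theorems.PowerGaugeEulerLiouville.SwirlCapacity

end
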